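import Summits.QuantumFields.QCD.Theorems.MobilityGap.Negative.LowerPin
import Summits.QuantumFields.QCD.Theorems.WilsonMobilityGapChiralMobilityGapStubSlowChannel
import Summits.QuantumFields.QCD.Theorems.WilsonMobilityGapChiralMobilityGapStubPionSigned
import Summits.QuantumFields.QCD.Theorems.WilsonMobilityGapChiralMobilityGapStubMomentCompare
import Summits.QuantumFields.QCD.Theorems.WilsonMobilityGapChiralMobilityGapStubDetTwo
import Summits.QuantumFields.QCD.Theorems.WilsonMobilityGapChiralMobilityGapStubAcrossK
import Literature.MathematicalPhysics.QuantumFieldTheory.QCDGoldstoneBound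
import Literature.MathematicalPhysics.QuantumFieldTheory.QCDPhaseQuenchedPositivity

/-!
# Crux `ChiralMobilityGap` (stmt-QuantumFields-17497), line `Sketch` (card `pin-rides-on-lower-clause`) —
# the two FIRST LEMMAS, definition-free: the chiral pin `reg.IsChiralAtZero` from clause (iii) with
# vanishing rate

Helper file of the line lead (`--supports stmt-QuantumFields-17497`), composing the five landed stubs of
wave 1 (`stub_slowChannel`, `stub_pionSigned`, `stub_momentCompare`, `stub_detTwo`, `stub_acrossK`):

* `stub_pinTwo` (registered stub G of the skeleton) — for a TWO-flavour Wilson regularisation, if for every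
  `ε > 0` some degenerate positive doublet `(t,t)` carries clause (iii) LOWER of the crux with constants of
  physical rate `2C₁/s < ε`, then `reg.IsChiralAtZero`.  Mechanism: the charged-pion pair
  `(ψ̄₁γ₅ψ₀)(0)·(ψ̄₀γ₅ψ₁)(n e₀)` is flavour-charged (connected = full), its SIGNED correlator is
  `−∫det D·X/∫det D` with `X = Σ|G₀(0,n e₀)|²` (Wick), the signed weight of a degenerate doublet IS the
  phase-quenched one (`det D = (det D_t)² = |det D|`), so `‖corr‖ = E₊[X] ≥ fm(s)^{2/s}/144 ≥
  (c₀^{2/s}/144) e^{-((2C₁/s) a_k n + (2p/s) log(n+1))}` on every torus `S ≥ L_k`, `n ≤ S`, eventually in `k`;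
  one slow channel at fixed `k` with `S = n → ∞` kills `HasLatticeMassGap ε`.  No Goldstone theorem, no
  statement about arbitrary observables, no `{det = 0}`-analyticity beyond the landed a.e. lemma.
* `stub_pinThree` (registered stub H) — the THREE-flavour version needs, besides the vanishing
  rate, clause (iv) SIGN at every degenerate triple (denominator `0 < ‖∫det‖ ≤ ∫|det|`), super-logarithmic
  volumes `a_k L_k / log(L_k+2) → ∞` and ONE sign input at the scheme's own side: sign coherence of the
  pion-WEIGHTED determinant, `c ∫|det D| X_k ≤ ‖∫ det D · X_k‖` at side `2L_k+1`, `n = L_k`; the pin is then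
  witnessed ACROSS `k` (`QCDScheme.not_hasLatticeMassGap_of_frequently_slow_decay`).
Statements use only landed vocabulary (`MobilityGapNegative.fm/bare/Sign`, `qcdLatticeConnectedCorr`, …);
the line's named predicates (`VanishingChiralRate`, `SuperLogVolume`, `PionWeightSignCoherent`) unfold to
exactly these hypotheses.
-/

noncomputable section

namespace Summit.QuantumFields.QCD.Theorems.ChiralMobilityGapSketch

open scoped BigOperators Topology
open MeasureTheory Filter Set
open Literature.MathematicalPhysics.QuantumFieldTheory Literature.MathematicalPhysics.QuantumLattice
  Literature.Probability.LatticeModels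
open Summit.QuantumFields.QCD.Theorems.MobilityGapNegative (bare fm Sign)

variable {Nf : ℕ}

/-- The phase-quenched expectation of a real observable, cast to `ℂ`, is the complex quotient
`∫ (|det D| : ℂ) φ / ∫ (|det D| : ℂ)`. -/
theorem ofReal_qcdPhaseQuenchedExpect {S : ℕ} [NeZero S] (β : ℝ) (mq : Fin Nf → ℝ)
    (φ : GaugeConfig 4 S SU3 → ℝ) :
    ((qcdPhaseQuenchedExpect β S mq φ : ℝ) : ℂ) =
      (∫ U, (‖(diracMatrix U mq).det‖ : ℂ) * ((φ U : ℝ) : ℂ)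
          ∂(wilsonMeasure (d := 4) (L := S) (fundamentalRep (Fin 3)) β)) /
        ∫ U, (‖(diracMatrix U mq).det‖ : ℂ) ∂(wilsonMeasure (d := 4) (L := S) (fundamentalRep (Fin 3)) β) := by
  rw [qcdPhaseQuenchedExpect_eq_div, Complex.ofReal_div, ← integral_complex_ofReal, ← integral_complex_ofReal]
  simp only [Complex.ofReal_mul]

/-- **The `N_f = 2` first lemma (definition-free).** Clause (iii) along degenerate doublets with
VANISHING physical rate (`2C₁/s < ε` attainable for every `ε > 0`) implies the chiral pin
`reg.IsChiralAtZero`: for `ε > 0` take the doublet `(t,t)`; the charged-pion pair has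
`‖corr‖ = E₊[Σ|G|²] ≥ fm(s)^{2/s}/144 ≥ (c₀^{2/s}/144) e^{-((2C₁/s) a_k n + (2p/s) log(n+1))}` on every torus
`S ≥ L_k`, `n ≤ S`, eventually in `k` (`stub_pionSigned`, `stub_detTwo`, `stub_momentCompare`), and
`2C₁/s < ε` kills the uniform gap (`stub_slowChannel`). -/
theorem stub_pinTwo :
    ∀ reg : QCDRegularisation 2,
      (∀ ε > (0 : ℝ), ∃ t : ℝ, 0 < t ∧ ∃ s c₀ C₁ p : ℝ, 0 < s ∧ s < 1 ∧ 0 < c₀ ∧ 2 * C₁ < s * ε ∧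
        ∀ᶠ k in atTop, ∀ S : ℕ, reg.L k ≤ S → ∀ (f : Fin 2) (n : ℕ), n ≤ S →
          c₀ * Real.exp (-(C₁ * (reg.a k * n) + p * Real.log (n + 1))) ≤
            fm 2 (reg.β k) (bare reg (fun _ => t) k) S f (Pi.single 0 (n : ℤ)) s) →
      reg.IsChiralAtZero := by
  intro reg hV ε hε
  obtain ⟨t, ht, s, c₀, C₁, p, hs, hs1, hc₀, hC, hLow⟩ := hV ε hε
  refine ⟨fun _ => t, fun _ => ht, ?_⟩
  have hr : 2 * C₁ / s < ε := by rw [div_lt_iff₀ hs]; linarith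
  have hc : 0 < c₀ ^ (2 / s) / 144 := by positivity
  refine stub_slowChannel (reg.scheme (fun _ => t) 0 0) (p := 2 * p / s) hr hc
    (pseudoscalarDensityObs 2 (Matrix.single (1 : Fin 2) 0 (1 : ℂ)))
    (pseudoscalarDensityObs 2 (Matrix.single (0 : Fin 2) 1 (1 : ℂ))) ?_
  filter_upwards [hLow] with k hk S hS n hn
  -- the data at step `k`
  set c : ℝ := reg.mcrit k + reg.a k * t / reg.Zm k with hcdef
  have hbare : bare reg (fun _ => t) k = fun _ : Fin 2 => c := rfl
  have hmq : (fun fl => (reg.scheme (fun _ => t) 0 0).mq fl k) = fun _ : Fin 2 => c := rfl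
  have hβ : (reg.scheme (fun _ => t) 0 0).β k = reg.β k := rfl
  set X : GaugeConfig 4 (2 * S + 1) SU3 → ℝ := fun U => ∑ a : Fin 3, ∑ i : Fin 4, ∑ b : Fin 3, ∑ j : Fin 4,
    ‖(diracMatrix U (fun _ : Fin 2 => c))⁻¹ (quarkEquiv ((0 : Fin 2), (Torus.proj (2 * S + 1) 0, a, i)))
      (quarkEquiv ((0 : Fin 2), (Torus.proj (2 * S + 1) (Pi.single 0 (n : ℤ)), b, j)))‖ ^ (2 : ℕ) with hXdef
  have hX0 : ∀ U, 0 ≤ X U := fun U => by positivity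
  -- the signed correlator is minus the phase-quenched pion second moment
  have hcorr : qcdLatticeConnectedCorr ((reg.scheme (fun _ => t) 0 0).β k) (2 * S + 1)
      (fun fl => (reg.scheme (fun _ => t) 0 0).mq fl k)
      (pseudoscalarDensityObs 2 (Matrix.single (1 : Fin 2) 0 (1 : ℂ)))
      (pseudoscalarDensityObs 2 (Matrix.single (0 : Fin 2) 1 (1 : ℂ))) n =
      -((qcdPhaseQuenchedExpect (reg.β k) (2 * S + 1) (fun _ : Fin 2 => c) X : ℝ) : ℂ) := by
    rw [hmq, hβ, stub_pionSigned (reg.β k) S (fun _ : Fin 2 => c) 0 1 zero_ne_one rfl n,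
      ofReal_qcdPhaseQuenchedExpect]
    congr 1
    have h1 : (fun U : GaugeConfig 4 (2 * S + 1) SU3 => (diracMatrix U (fun _ : Fin 2 => c)).det * ((X U : ℝ) : ℂ)) =
        fun U => (‖(diracMatrix U (fun _ : Fin 2 => c)).det‖ : ℂ) * ((X U : ℝ) : ℂ) := by
      funext U; exact congrArg (fun z : ℂ => z * ((X U : ℝ) : ℂ)) (stub_detTwo U c)
    have h2 : (fun U : GaugeConfig 4 (2 * S + 1) SU3 => (diracMatrix U (fun _ : Fin 2 => c)).det) =
        fun U => (‖(diracMatrix U (fun _ : Fin 2 => c)).det‖ : ℂ) := by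
      funext U; exact stub_detTwo U c
    rw [h1, h2]
  have hE0 : 0 ≤ qcdPhaseQuenchedExpect (reg.β k) (2 * S + 1) (fun _ : Fin 2 => c) X := by
    rw [qcdPhaseQuenchedExpect_eq_integral_qcdLatticeMeasure]
    exact integral_nonneg hX0
  have hnorm : ‖qcdLatticeConnectedCorr ((reg.scheme (fun _ => t) 0 0).β k) (2 * S + 1)
      (fun fl => (reg.scheme (fun _ => t) 0 0).mq fl k)
      (pseudoscalarDensityObs 2 (Matrix.single (1 : Fin 2) 0 (1 : ℂ)))
      (pseudoscalarDensityObs 2 (Matrix.single (0 : Fin 2) 1 (1 : ℂ))) n‖ =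
      qcdPhaseQuenchedExpect (reg.β k) (2 * S + 1) (fun _ : Fin 2 => c) X := by
    rw [hcorr, norm_neg, Complex.norm_real, Real.norm_eq_abs, abs_of_nonneg hE0]
  -- moments: `fm(s)^{2/s} ≤ 144 E₊[X]`
  have hmom := stub_momentCompare (Nf := 2) le_rfl (reg.β k) c S 0 (Pi.single 0 (n : ℤ)) hs hs1.le
  -- the lower bound of clause (iii) at flavour `0`
  have hlow : c₀ * Real.exp (-(C₁ * (reg.a k * n) + p * Real.log (n + 1))) ≤
      fm 2 (reg.β k) (fun _ => c) S 0 (Pi.single 0 (n : ℤ)) s := by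
    have := hk S hS 0 n hn
    rwa [hbare] at this
  have hq : 0 ≤ 2 / s := by positivity
  have hpow := Real.rpow_le_rpow (by positivity) hlow hq
  have hval : (c₀ * Real.exp (-(C₁ * (reg.a k * n) + p * Real.log (n + 1)))) ^ (2 / s) =
      c₀ ^ (2 / s) * Real.exp (-(2 * C₁ / s * (reg.a k * n) + 2 * p / s * Real.log (n + 1))) := by
    rw [Real.mul_rpow hc₀.le (Real.exp_pos _).le, ← Real.exp_mul]
    congr 2
    ring
  rw [hnorm]
  change c₀ ^ (2 / s) / 144 * Real.exp (-(2 * C₁ / s * (reg.a k * n) + 2 * p / s * Real.log (n + 1))) ≤ _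
  have h144 : c₀ ^ (2 / s) * Real.exp (-(2 * C₁ / s * (reg.a k * n) + 2 * p / s * Real.log (n + 1))) ≤
      144 * qcdPhaseQuenchedExpect (reg.β k) (2 * S + 1) (fun _ : Fin 2 => c) X := by
    rw [← hval]; exact hpow.trans hmom
  linarith

/-- **The `N_f = 3` first lemma (definition-free, given the sign input).** With clause (iv) SIGN along
degenerate triples (the signed denominator at side `2L_k+1` is non-zero and at most `∫|det D|`),
super-logarithmic volumes and sign coherence of the pion-weighted determinant at the scheme's own side,
clause (iii) with vanishing physical rate implies the chiral pin, witnessed ACROSS `k` at `n = S = L_k`: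
`‖corr_k‖ ≥ c E₊[X_k] ≥ (c c₀^{2/s}/144) e^{-((2C₁/s) a_k L_k + (2p/s) log(L_k+1))} ≥ e^{-μ a_k L_k}` eventually,
`μ = (2C₁/s + ε)/2 < ε` (`stub_pionSigned`, `stub_momentCompare`, `stub_acrossK`,
`QCDScheme.not_hasLatticeMassGap_of_frequently_slow_decay`). -/
theorem stub_pinThree :
    ∀ reg : QCDRegularisation 3, (∀ t : ℝ, 0 < t → Sign reg (fun _ => t)) →
      Tendsto (fun k => reg.a k * reg.L k / Real.log ((reg.L k : ℝ) + 2)) atTop atTop →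
      (∀ t : ℝ, 0 < t → ∃ c : ℝ, 0 < c ∧ ∀ᶠ k in atTop,
        c * ∫ U : GaugeConfig 4 (2 * reg.L k + 1) SU3,
            ‖(diracMatrix U (fun _ : Fin 3 => reg.mcrit k + reg.a k * t / reg.Zm k)).det‖ *
              (∑ a : Fin 3, ∑ i : Fin 4, ∑ b : Fin 3, ∑ j : Fin 4,
                ‖(diracMatrix U (fun _ : Fin 3 => reg.mcrit k + reg.a k * t / reg.Zm k))⁻¹
                  (quarkEquiv ((0 : Fin 3), (Torus.proj (2 * reg.L k + 1) 0, a, i)))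
                  (quarkEquiv ((0 : Fin 3), (Torus.proj (2 * reg.L k + 1) (Pi.single 0 (reg.L k : ℤ)), b, j)))‖ ^ (2 : ℕ))
            ∂(wilsonMeasure (fundamentalRep (Fin 3)) (reg.β k)) ≤
          ‖∫ U : GaugeConfig 4 (2 * reg.L k + 1) SU3,
            (diracMatrix U (fun _ : Fin 3 => reg.mcrit k + reg.a k * t / reg.Zm k)).det *
              (((∑ a : Fin 3, ∑ i : Fin 4, ∑ b : Fin 3, ∑ j : Fin 4,
                ‖(diracMatrix U (fun _ : Fin 3 => reg.mcrit k + reg.a k * t / reg.Zm k))⁻¹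
                  (quarkEquiv ((0 : Fin 3), (Torus.proj (2 * reg.L k + 1) 0, a, i)))
                  (quarkEquiv ((0 : Fin 3), (Torus.proj (2 * reg.L k + 1) (Pi.single 0 (reg.L k : ℤ)), b, j)))‖ ^ (2 : ℕ) : ℝ) : ℝ) : ℂ)
            ∂(wilsonMeasure (fundamentalRep (Fin 3)) (reg.β k))‖) →
      (∀ ε > (0 : ℝ), ∃ t : ℝ, 0 < t ∧ ∃ s c₀ C₁ p : ℝ, 0 < s ∧ s < 1 ∧ 0 < c₀ ∧ 2 * C₁ < s * ε ∧
        ∀ᶠ k in atTop, ∀ S : ℕ, reg.L k ≤ S → ∀ (f : Fin 3) (n : ℕ), n ≤ S →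
          c₀ * Real.exp (-(C₁ * (reg.a k * n) + p * Real.log (n + 1))) ≤
            fm 3 (reg.β k) (bare reg (fun _ => t) k) S f (Pi.single 0 (n : ℤ)) s) →
      reg.IsChiralAtZero := by
  intro reg hSignAll hL hσ hV ε hε
  obtain ⟨t, ht, s, c₀, C₁, p, hs, hs1, hc₀, hC₁, hLow⟩ := hV ε hε
  refine ⟨fun _ => t, fun _ => ht, ?_⟩
  obtain ⟨cσ, hcσ, hσk⟩ := hσ t ht
  have hSign : Sign reg (fun _ => t) := hSignAll t ht
  set r : ℝ := 2 * C₁ / s with hrdef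
  have hr : r < ε := by rw [hrdef, div_lt_iff₀ hs]; linarith
  set μ : ℝ := (r + ε) / 2 with hμdef
  have hrμ : r < μ := by rw [hμdef]; linarith
  have hμε : μ < ε := by rw [hμdef]; linarith
  have hK : 0 < cσ * c₀ ^ (2 / s) / 144 := by positivity
  have hacross := stub_acrossK reg.a reg.L reg.a_pos reg.tendsto_L hL (p := 2 * p / s) hrμ hK
  refine QCDScheme.not_hasLatticeMassGap_of_frequently_slow_decay (reg.scheme (fun _ => t) 0 0) hμε one_pos
    (pseudoscalarDensityObs 3 (Matrix.single (1 : Fin 3) 0 (1 : ℂ)))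
    (pseudoscalarDensityObs 3 (Matrix.single (0 : Fin 3) 1 (1 : ℂ)))
    (S := reg.L) (n := reg.L) (fun k => le_rfl) (fun k => le_rfl) reg.tendsto_L ?_
  refine Eventually.frequently ?_
  filter_upwards [hLow, hσk, hSign, hacross] with k hk hσk' hsg hak
  -- the data at step `k`
  set c : ℝ := reg.mcrit k + reg.a k * t / reg.Zm k with hcdef
  have hbare : bare reg (fun _ => t) k = fun _ : Fin 3 => c := rfl
  have hmq : (fun fl => (reg.scheme (fun _ => t) 0 0).mq fl k) = fun _ : Fin 3 => c := rfl
  have hβ : (reg.scheme (fun _ => t) 0 0).β k = reg.β k := rfl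
  set X : GaugeConfig 4 (2 * reg.L k + 1) SU3 → ℝ := fun U =>
      ∑ a : Fin 3, ∑ i : Fin 4, ∑ b : Fin 3, ∑ j : Fin 4,
        ‖(diracMatrix U (fun _ : Fin 3 => c))⁻¹ (quarkEquiv ((0 : Fin 3), (Torus.proj (2 * reg.L k + 1) 0, a, i)))
          (quarkEquiv ((0 : Fin 3), (Torus.proj (2 * reg.L k + 1) (Pi.single 0 (reg.L k : ℤ)), b, j)))‖ ^ (2 : ℕ)
    with hXdef
  have hX0 : ∀ U, 0 ≤ X U := fun U => by rw [hXdef]; positivity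
  -- the signed correlator
  have hcorr : qcdLatticeConnectedCorr ((reg.scheme (fun _ => t) 0 0).β k) (2 * reg.L k + 1)
      (fun fl => (reg.scheme (fun _ => t) 0 0).mq fl k)
      (pseudoscalarDensityObs 3 (Matrix.single (1 : Fin 3) 0 (1 : ℂ)))
      (pseudoscalarDensityObs 3 (Matrix.single (0 : Fin 3) 1 (1 : ℂ))) (reg.L k) =
      -((∫ U, (diracMatrix U (fun _ : Fin 3 => c)).det * ((X U : ℝ) : ℂ)
            ∂(wilsonMeasure (d := 4) (L := 2 * reg.L k + 1) (fundamentalRep (Fin 3)) (reg.β k))) /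
          (∫ U, (diracMatrix U (fun _ : Fin 3 => c)).det
            ∂(wilsonMeasure (d := 4) (L := 2 * reg.L k + 1) (fundamentalRep (Fin 3)) (reg.β k)))) := by
    rw [hmq, hβ, stub_pionSigned (reg.β k) (reg.L k) (fun _ : Fin 3 => c) 0 1 zero_ne_one rfl (reg.L k)]
  -- denominators: `0 < ‖∫ det‖ ≤ ∫ |det|` (clause (iv) at the scheme's own side)
  have hZ : 0 < ∫ U, ‖(diracMatrix U (fun _ : Fin 3 => c)).det‖
      ∂(wilsonMeasure (d := 4) (L := 2 * reg.L k + 1) (fundamentalRep (Fin 3)) (reg.β k)) :=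
    integral_norm_det_diracMatrix_pos_all (S := 2 * reg.L k + 1) (reg.β k) (fun _ : Fin 3 => c)
  have hsg' : (1 / 2 : ℝ) ≤
      ‖∫ U, (diracMatrix U (fun _ : Fin 3 => c)).det
          ∂(wilsonMeasure (d := 4) (L := 2 * reg.L k + 1) (fundamentalRep (Fin 3)) (reg.β k))‖ /
        ∫ U, ‖(diracMatrix U (fun _ : Fin 3 => c)).det‖
          ∂(wilsonMeasure (d := 4) (L := 2 * reg.L k + 1) (fundamentalRep (Fin 3)) (reg.β k)) := hsg
  have hD0 : 0 < ‖∫ U, (diracMatrix U (fun _ : Fin 3 => c)).det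
      ∂(wilsonMeasure (d := 4) (L := 2 * reg.L k + 1) (fundamentalRep (Fin 3)) (reg.β k))‖ := by
    have h1 : (0 : ℝ) < 1 / 2 * ∫ U, ‖(diracMatrix U (fun _ : Fin 3 => c)).det‖
        ∂(wilsonMeasure (d := 4) (L := 2 * reg.L k + 1) (fundamentalRep (Fin 3)) (reg.β k)) :=
      mul_pos (by norm_num) hZ
    exact h1.trans_le ((le_div_iff₀ hZ).1 hsg')
  have hDle : ‖∫ U, (diracMatrix U (fun _ : Fin 3 => c)).det
      ∂(wilsonMeasure (d := 4) (L := 2 * reg.L k + 1) (fundamentalRep (Fin 3)) (reg.β k))‖ ≤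
      ∫ U, ‖(diracMatrix U (fun _ : Fin 3 => c)).det‖
        ∂(wilsonMeasure (d := 4) (L := 2 * reg.L k + 1) (fundamentalRep (Fin 3)) (reg.β k)) :=
    norm_integral_le_integral_norm _
  -- numerator: sign coherence of the pion weight
  have hNum : cσ * ∫ U, ‖(diracMatrix U (fun _ : Fin 3 => c)).det‖ * X U
      ∂(wilsonMeasure (d := 4) (L := 2 * reg.L k + 1) (fundamentalRep (Fin 3)) (reg.β k)) ≤
      ‖∫ U, (diracMatrix U (fun _ : Fin 3 => c)).det * ((X U : ℝ) : ℂ)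
        ∂(wilsonMeasure (d := 4) (L := 2 * reg.L k + 1) (fundamentalRep (Fin 3)) (reg.β k))‖ := hσk'
  -- `‖corr‖ ≥ cσ E₊[X]`
  have hE : qcdPhaseQuenchedExpect (reg.β k) (2 * reg.L k + 1) (fun _ : Fin 3 => c) X =
      (∫ U, ‖(diracMatrix U (fun _ : Fin 3 => c)).det‖ * X U
          ∂(wilsonMeasure (d := 4) (L := 2 * reg.L k + 1) (fundamentalRep (Fin 3)) (reg.β k))) /
        ∫ U, ‖(diracMatrix U (fun _ : Fin 3 => c)).det‖
          ∂(wilsonMeasure (d := 4) (L := 2 * reg.L k + 1) (fundamentalRep (Fin 3)) (reg.β k)) :=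
    qcdPhaseQuenchedExpect_eq_div _ _ _
  have hstep1 : cσ * qcdPhaseQuenchedExpect (reg.β k) (2 * reg.L k + 1) (fun _ : Fin 3 => c) X ≤
      ‖qcdLatticeConnectedCorr ((reg.scheme (fun _ => t) 0 0).β k) (2 * reg.L k + 1)
        (fun fl => (reg.scheme (fun _ => t) 0 0).mq fl k)
        (pseudoscalarDensityObs 3 (Matrix.single (1 : Fin 3) 0 (1 : ℂ)))
        (pseudoscalarDensityObs 3 (Matrix.single (0 : Fin 3) 1 (1 : ℂ))) (reg.L k)‖ := by
    rw [hcorr, norm_neg, norm_div, hE, mul_div_assoc']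
    exact (div_le_div_of_nonneg_right hNum hZ.le).trans
      (div_le_div_of_nonneg_left (norm_nonneg _) hD0 hDle)
  -- moments and the lower bound of (iii) at `n = S = L_k`, flavour `0`
  have hmom : fm 3 (reg.β k) (fun _ => c) (reg.L k) 0 (Pi.single 0 (reg.L k : ℤ)) s ^ (2 / s) ≤
      144 * qcdPhaseQuenchedExpect (reg.β k) (2 * reg.L k + 1) (fun _ : Fin 3 => c) X :=
    stub_momentCompare (Nf := 3) (by norm_num) (reg.β k) c (reg.L k) 0 (Pi.single 0 (reg.L k : ℤ)) hs hs1.le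
  have hlow : c₀ * Real.exp (-(C₁ * (reg.a k * reg.L k) + p * Real.log (reg.L k + 1))) ≤
      fm 3 (reg.β k) (fun _ => c) (reg.L k) 0 (Pi.single 0 (reg.L k : ℤ)) s := by
    have := hk (reg.L k) le_rfl 0 (reg.L k) le_rfl
    rwa [hbare] at this
  have hq : 0 ≤ 2 / s := by positivity
  have hpow := Real.rpow_le_rpow (by positivity) hlow hq
  have hval : (c₀ * Real.exp (-(C₁ * (reg.a k * reg.L k) + p * Real.log (reg.L k + 1)))) ^ (2 / s) =
      c₀ ^ (2 / s) * Real.exp (-(r * (reg.a k * reg.L k) + 2 * p / s * Real.log (reg.L k + 1))) := by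
    rw [Real.mul_rpow hc₀.le (Real.exp_pos _).le, ← Real.exp_mul, hrdef]
    congr 2
    ring
  have hmom' : c₀ ^ (2 / s) * Real.exp (-(r * (reg.a k * reg.L k) + 2 * p / s * Real.log (reg.L k + 1))) ≤
      144 * qcdPhaseQuenchedExpect (reg.β k) (2 * reg.L k + 1) (fun _ : Fin 3 => c) X := by
    rw [← hval]
    exact hpow.trans hmom
  -- assemble
  have hfin : cσ * c₀ ^ (2 / s) / 144 *
      Real.exp (-(r * (reg.a k * reg.L k) + 2 * p / s * Real.log (reg.L k + 1))) ≤
      cσ * qcdPhaseQuenchedExpect (reg.β k) (2 * reg.L k + 1) (fun _ : Fin 3 => c) X := by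
    have := mul_le_mul_of_nonneg_left hmom' hcσ.le
    linarith
  rw [one_mul]
  exact hak.trans (hfin.trans hstep1)

end Summit.QuantumFields.QCD.Theorems.ChiralMobilityGapSketch

end
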